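import Summits.NavierStokesRegularity.NavierStokesRegularity.Theses.QuantisedSymmetry
import Summits.NavierStokesRegularity.NavierStokesRegularity.Theses.Blowup
import Summits.NavierStokesRegularity.NavierStokesRegularity.Theses.AdaptedFrequency
import Summits.NavierStokesRegularity.NavierStokesRegularity.Theorems.QuantisedSymmetryPolyhedralTruncationBridge
import Summits.NavierStokesRegularity.NavierStokesRegularity.Theorems.QuantisedSymmetryPolyhedralDssProfileExistsDominatesBlowupProfile
import Summits.NavierStokesRegularity.NavierStokesRegularity.Theorems.QuantisedSymmetryPolyhedralDssProfileExistsStubPeriodWindow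
import Summits.NavierStokesRegularity.NavierStokesRegularity.Theorems.QuantisedSymmetryLiouvilleKillsProfile
import Literature.Analysis.FluidPDE.SelfSimilarLiouville
import Literature.Analysis.Calculus.SimplifiedNewtonKantorovich
import HarnessLib

/-!
# Strategist sketch `s21-g14` (family `s`, independent census) for crux
  `QuantisedSymmetry.PolyhedralDssProfileExists` (stmt-NavierStokesRegularity-1404)

Typed companion of `STRATEGY-CENSUS-s21.md`.  Sorry-free.  Four blocks:

* §1 WEAKER INTERMEDIATES.  The chain
  `X ⇒ SectorFreeDssProfileExists ⇒ Blowup.BlowupTypeIDssProfile ⇒ FiniteLifespanDatumExists ⇒ ¬S`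
  and the side rung `TypeIBlowupExists (= ¬ AdaptedFrequency.NoTypeIBlowup) ⇒ FiniteLifespanDatumExists`,
  every arrow a theorem of this file over landed tree theorems: every intermediate that can replace
  the crux in `closes` is itself summit-deciding, and each one is an EXISTING item of another route
  (stmt-0155, the antecedent of stmt-11289, ¬stmt-1217) or the summit's negation read through
  `ClayUniqueness` (X5a).
* §2 STRENGTHEN.  The exactly-self-similar strengthening `S⁺_SS` is REFUTED in the tree
  (`not_selfSimilarPolyhedralProfileExists`, from the landed `stub_periodWindow` = Chae–Wolf 2017 Thm 1.3
  near `λ = 1`), so rigidity in the scaling group buys nothing.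
* §3 DECOMPOSITION.  The Newton–Kantorovich / computer-assisted split: the abstract NK theorem is
  ALREADY a tree theorem (`Literature.Analysis.Calculus.simplifiedNewtonKantorovich_exists_zero_tendsto`),
  the assembly `crux_of_nkCertificate` is proved, and the collapse `nkCertificate_of_crux` shows the
  one remaining piece is `↔ X` as long as the map `F` and the approximate zero `x₀` are existentially
  quantified rather than pinned to concrete definitions — i.e. the split has k = 1 open piece until a
  numerical candidate exists (none does: EVENMAP j026211 is 1-D calibration only).
* §4 NEGATION.  `¬X` is the existing kill-switch item stmt-1405 (`PolyhedralTypeILiouville → ¬X`,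
  landed as `quantisedSymmetry_liouvilleKillsProfile_proof`).
-/

set_option linter.dupNamespace false
set_option autoImplicit false

namespace Summit.NavierStokesRegularity.NavierStokesRegularity.Cruxes.PolyhedralDssProfileExists.StrategistS21g14

open MeasureTheory Set Filter Metric Topology
open Literature.Analysis.FluidPDE
open _root_.Summit.NavierStokesRegularity.NavierStokesRegularity.Theses.QuantisedSymmetry
  (PolyhedralDssProfileExists PolyhedralTypeILiouville ClayUniqueness_holds)
open _root_.Summit.NavierStokesRegularity.NavierStokesRegularity.Theses.Blowup (BlowupTypeIDssProfile)
open _root_.Summit.NavierStokesRegularity.NavierStokesRegularity.Theses.AdaptedFrequency (NoTypeIBlowup)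
open _root_.Summit.NavierStokesRegularity.NavierStokesRegularity.Theorems
  (filamentSkeletonRss_rdssProfileTruncation_proof quantisedSymmetry_liouvilleKillsProfile_proof)
open _root_.Summit.NavierStokesRegularity.NavierStokesRegularity.Theorems.PolyhedralDssProfileExists.PolyhedralCell
  (exists_not_typeIDSSLiouville_of_polyhedralDssProfileExists stub_periodWindow)

/-- Physical space `ℝ³`. -/
local notation "ℝ³" => EuclideanSpace ℝ (Fin 3)

/-! ## §1 Weaker intermediates between the crux and `¬S` -/

/-- **W1** (drop the symmetry group): a nontrivial Type-I `λ`-DSS ancient mild profile exists for some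
`λ > 1`, i.e. Tsai's `λ`-DSS Liouville statement fails at some factor.  This is the first conjunct of
`¬ Blowup.BlowupTypeIDssProfile`'s body (stmt-NavierStokesRegularity-0155). -/
def SectorFreeDssProfileExists : Prop := ∃ c : ℝ, 1 < c ∧ ¬ TypeIDSSLiouville c

/-- **X5a** (the bottom of the chain): some rapidly decaying datum has a Leray–Hopf classical
solution of finite maximal lifespan — literally the conclusion of the landed rotated truncation
bridge `FilamentSkeletonRss.RdssProfileTruncation` (stmt-NavierStokesRegularity-11289). -/
def FiniteLifespanDatumExists : Prop :=
  ∃ ν : ℝ, 0 < ν ∧ ∃ T : ℝ, 0 < T ∧ ∃ (u : ℝ → ℝ³ → ℝ³) (p : ℝ → ℝ³ → ℝ),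
    IsMaximalSmoothSolution ν 0 u p T ∧ IsLerayHopfOn T ν 0 (u 0) u ∧ HasRapidSpatialDecay (u 0)

/-- **W-a** (drop self-similarity altogether, keep only the Type-I rate): a Type-I blow-up from a
rapidly decaying datum exists = the negation of the shared item `AdaptedFrequency.NoTypeIBlowup`
(stmt-NavierStokesRegularity-1217). -/
def TypeIBlowupExists : Prop := ¬ NoTypeIBlowup

/-- `X ⇒ W1` (landed: `exists_not_typeIDSSLiouville_of_polyhedralDssProfileExists`). -/
theorem sectorFree_of_crux (hX : PolyhedralDssProfileExists) : SectorFreeDssProfileExists :=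
  exists_not_typeIDSSLiouville_of_polyhedralDssProfileExists hX

/-- `W1 ⇒ W0 = Blowup.BlowupTypeIDssProfile` (stmt-0155). -/
theorem blowupProfile_of_sectorFree (h : SectorFreeDssProfileExists) : BlowupTypeIDssProfile := by
  obtain ⟨c, -, hc⟩ := h
  dsimp only [BlowupTypeIDssProfile]
  exact fun hL => hc (hL c).1

/-- `W0 ⇒ X5a`: the landed rotated truncation bridge `filamentSkeletonRss_rdssProfileTruncation_proof`
applies to EVERY nontrivial Type-I (rotated) DSS profile, with or without symmetry. -/
theorem finiteLifespan_of_blowupProfile (h : BlowupTypeIDssProfile) : FiniteLifespanDatumExists := by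
  by_contra hX
  apply h
  intro c
  have key : ∀ R : ℝ³ ≃ₗᵢ[ℝ] ℝ³, RotatedTypeIDSSLiouville c R := by
    intro R
    unfold RotatedTypeIDSSLiouville
    intro hc u hanc hmeas hrdss hdec
    by_contra hnt
    exact hX (filamentSkeletonRss_rdssProfileTruncation_proof ⟨c, R, u, hc, hanc, hmeas, hrdss, hdec, hnt⟩)
  exact ⟨(rotatedTypeIDSSLiouville_refl_iff c).mp (key _), key⟩

/-- `W-a ⇒ X5a`: forget the rate. -/
theorem finiteLifespan_of_typeIBlowup (h : TypeIBlowupExists) : FiniteLifespanDatumExists := by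
  unfold TypeIBlowupExists NoTypeIBlowup at h
  push_neg at h
  obtain ⟨ν, T, hν, hT, u, p, hcl, hLH, hdec, -, hnext⟩ := h
  exact ⟨ν, hν, T, hT, u, p, ⟨hcl, hnext⟩, hLH, hdec⟩

/-- `X5a ⇒ ¬S` (the `closes` argument of the route with the landed `ClayUniqueness_holds`: Clay (A) on
the datum gives a global smooth bounded-energy solution, weak–strong uniqueness glues it to the
maximal solution on `[0,T)`, which then extends past `T`). -/
theorem not_regularity_of_finiteLifespan (h : FiniteLifespanDatumExists) : ¬ _root_.NavierStokesRegularity := by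
  rintro hA
  obtain ⟨ν, hν, T, hT, u, p, ⟨hcl, hmax⟩, hLH, hdecay⟩ := h
  have h0 : (0 : ℝ) ∈ Set.Ico 0 T := ⟨le_rfl, hT⟩
  obtain ⟨u', p', hu', hp', hns, hbe⟩ :=
    hA ν hν (u 0) (hcl.contDiff_velocity h0) (hcl.divFree 0 h0) hdecay
  have heq : ∀ t ∈ Set.Ico 0 T, u' t = u t :=
    ClayUniqueness_holds ν hν (u 0) hdecay u' u p' p T hT hu' hp' hns hbe hcl hLH rfl
  have hcl' : IsClassicalNSSolutionOn (Set.Ici 0) ν 0 u' p' :=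
    ⟨hu', hp', fun t ht x => hns.momentum t ht x, fun t ht => hns.divFree t ht⟩
  refine hmax ⟨T + 1, by linarith, u', p', ?_, heq⟩
  exact hcl'.mono (fun t ht => ht.1) (uniqueDiffOn_Ico 0 (T + 1))

/-- Every rung of the chain decides the summit: `W1 ⇒ ¬S`. -/
theorem not_regularity_of_sectorFree (h : SectorFreeDssProfileExists) : ¬ _root_.NavierStokesRegularity :=
  not_regularity_of_finiteLifespan (finiteLifespan_of_blowupProfile (blowupProfile_of_sectorFree h))

/-- `W0 ⇒ ¬S` (so the sibling crux stmt-0155 is itself summit-deciding, unconditionally). -/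
theorem not_regularity_of_blowupProfile (h : BlowupTypeIDssProfile) : ¬ _root_.NavierStokesRegularity :=
  not_regularity_of_finiteLifespan (finiteLifespan_of_blowupProfile h)

/-- `W-a ⇒ ¬S`. -/
theorem not_regularity_of_typeIBlowup (h : TypeIBlowupExists) : ¬ _root_.NavierStokesRegularity :=
  not_regularity_of_finiteLifespan (finiteLifespan_of_typeIBlowup h)

/-- The crux decides the summit through the chain (same content as the route's `closes`). -/
theorem not_regularity_of_crux (hX : PolyhedralDssProfileExists) : ¬ _root_.NavierStokesRegularity :=
  not_regularity_of_sectorFree (sectorFree_of_crux hX)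

/-! ## §2 Strengthen: exact self-similarity is refuted -/

/-- **S⁺_SS**: the crux with `IsDiscretelySelfSimilar c u` (one factor) strengthened to exact
self-similarity `IsSelfSimilar u` (every factor). -/
def SelfSimilarPolyhedralProfileExists : Prop :=
  ∃ G : Subgroup (ℝ³ ≃ₗᵢ[ℝ] ℝ³), Finite G ∧
    (∀ g ∈ G, LinearMap.det (g.toLinearEquiv : ℝ³ →ₗ[ℝ] ℝ³) = 1) ∧
    (∀ V : Submodule ℝ ℝ³, (∀ g ∈ G, ∀ v ∈ V, g v ∈ V) → V = ⊥ ∨ V = ⊤) ∧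
    ∃ u : ℝ → ℝ³ → ℝ³, IsAncientMildSolution 1 u ∧ (∀ t < 0, AEStronglyMeasurable (u t) volume) ∧
      IsSelfSimilar u ∧ (∃ C₀ : ℝ, HasTypeIDecay C₀ u) ∧ (∀ g ∈ G, ∀ t x, u t (g x) = g (u t x)) ∧
      ¬ (∀ t < 0, u t =ᵐ[volume] 0)

/-- **S⁺_SS is false**: a self-similar profile is `c`-DSS for every `c > 1`, in particular for a factor
inside the Chae–Wolf window `(1, c₁(C₀))` of the landed `stub_periodWindow`; for `C₀ ≤ 0` the Type-I
bound already forces `u ≡ 0` on the past. -/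
theorem not_selfSimilarPolyhedralProfileExists : ¬ SelfSimilarPolyhedralProfileExists := by
  rintro ⟨G, -, -, -, u, hanc, hmeas, hss, ⟨C₀, hdec⟩, -, hnt⟩
  apply hnt
  by_cases hC₀ : 0 < C₀
  · obtain ⟨c₁, hc₁, hwin⟩ := stub_periodWindow C₀ hC₀
    have hc : 1 < (1 + c₁) / 2 := by linarith
    have hcc : (1 + c₁) / 2 < c₁ := by linarith
    exact hwin _ u hc hcc hanc hmeas (hss.isDiscretelySelfSimilar (by linarith)) hdec
  · push_neg at hC₀
    intro t ht
    have hut : u t = 0 := by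
      funext x
      have hden : 0 < ‖x‖ + Real.sqrt (-t) := by
        have : 0 < Real.sqrt (-t) := Real.sqrt_pos.mpr (by linarith)
        positivity
      have hle : C₀ / (‖x‖ + Real.sqrt (-t)) ≤ 0 := div_nonpos_of_nonpos_of_nonneg hC₀ hden.le
      exact norm_le_zero_iff.mp ((hdec t ht x).trans hle)
    rw [hut]

/-! ## §3 Decomposition: the Newton–Kantorovich / computer-assisted split -/

/-- **The one open piece of the NK split** — a real Banach space `E`, a map `F` differentiable on a
ball around `x₀` with an affine-covariant Lipschitz derivative, a Kantorovich certificate at `x₀`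
(`h₀ = ω₀ ‖F'(x₀)⁻¹F(x₀)‖ ≤ ½`, the Kantorovich ball inside the domain), and the SEMANTICS: zeros of
`F` in that ball are witnesses of the crux.  `F` and `x₀` are EXISTENTIALLY quantified here because no
concrete candidate exists to pin them to (that is the point made by `nkCertificate_of_crux`). -/
def NKCertificate : Prop :=
  ∃ (E : Type) (_ : NormedAddCommGroup E) (_ : NormedSpace ℝ E) (_ : CompleteSpace E)
    (F : E → E) (F' : E → E →L[ℝ] E) (x₀ : E) (ω₀ ρ : ℝ),
    (∀ z ∈ closedBall x₀ ρ, HasFDerivAt F (F' z) z) ∧ (F' x₀).IsInvertible ∧ 0 < ω₀ ∧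
    (∀ v ∈ closedBall x₀ ρ, ‖(F' x₀).inverse.comp (F' v - F' x₀)‖ ≤ ω₀ * ‖v - x₀‖) ∧
    ω₀ * ‖(F' x₀).inverse (F x₀)‖ ≤ 1 / 2 ∧
    (1 - Real.sqrt (1 - 2 * (ω₀ * ‖(F' x₀).inverse (F x₀)‖))) / ω₀ ≤ ρ ∧
    (∀ z ∈ closedBall x₀ ρ, F z = 0 → PolyhedralDssProfileExists)

/-- **Assembly of the NK split (proved)**: the certificate piece plus the abstract Newton–Kantorovich
theorem — ALREADY landed as `Literature.Analysis.Calculus.simplifiedNewtonKantorovich_exists_zero_tendsto`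
(Deuflhard 2011, Thm 2.5) — give the crux. -/
theorem crux_of_nkCertificate (h : NKCertificate) : PolyhedralDssProfileExists := by
  obtain ⟨E, _, _, _, F, F', x₀, ω₀, ρ, hF, hA, hω₀, hlip, hh₀, hρ, hsem⟩ := h
  -- the simplified Newton sequence from `x₀`
  let x : ℕ → E := fun k => Nat.rec x₀ (fun _ y => y - (F' x₀).inverse (F y)) k
  have hx0 : x 0 = x₀ := rfl
  have hx : ∀ k, x (k + 1) = x k - (F' (x 0)).inverse (F (x k)) := fun k => rfl
  have hx1 : x 1 - x 0 = -(F' x₀).inverse (F x₀) := by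
    show (x₀ - (F' x₀).inverse (F x₀)) - x₀ = _
    abel
  have hn : ‖x 1 - x 0‖ = ‖(F' x₀).inverse (F x₀)‖ := by rw [hx1, norm_neg]
  have hball : closedBall (x 0) ((1 - Real.sqrt (1 - 2 * (ω₀ * ‖x 1 - x 0‖))) / ω₀) ⊆ closedBall x₀ ρ := by
    rw [hn, hx0]
    exact closedBall_subset_closedBall hρ
  obtain ⟨xstar, hmem, hzero, -⟩ :=
    Literature.Analysis.Calculus.simplifiedNewtonKantorovich_exists_zero_tendsto (x := x)
      (convex_closedBall x₀ ρ) hF (by rw [hx0]; exact hA) hω₀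
      (by intro v hv; rw [hx0]; exact hlip v hv) hx (by rw [hn]; exact hh₀) hball
  exact hsem xstar (hball hmem) hzero

/-- **Collapse of the NK split**: with `F`, `x₀` existentially quantified the certificate piece is
implied by the crux (take `E = ℝ`, `F = id − x₀`, which has the exact zero `x₀`), so `NKCertificate ↔ X`
and the split has ONE open piece carrying the whole crux.  Only a PINNED `(F, x₀)` — a concrete
discretised period map and a numerically found approximate polyhedral DSS profile — would make the
certificate a statement strictly about a finite computation; no such candidate exists. -/
theorem nkCertificate_of_crux (hX : PolyhedralDssProfileExists) : NKCertificate := by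
  refine ⟨ℝ, inferInstance, inferInstance, inferInstance, fun z => z - 0, fun _ => ContinuousLinearMap.id ℝ ℝ,
    0, 1, 1, ?_, ?_, one_pos, ?_, ?_, ?_, fun _ _ _ => hX⟩
  · intro z _
    simpa using (hasFDerivAt_id z).sub_const (0 : ℝ)
  · exact ⟨ContinuousLinearEquiv.refl ℝ ℝ, ContinuousLinearEquiv.coe_refl⟩
  · intro v _
    simp
  · simp
  · simp

/-- The NK split is `k = 1`: its open piece is equivalent to the crux. -/
theorem nkCertificate_iff_crux : NKCertificate ↔ PolyhedralDssProfileExists :=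
  ⟨crux_of_nkCertificate, nkCertificate_of_crux⟩

/-! ## §4 Negation: the existing kill switch -/

/-- `¬X` is staffed already: the route's item stmt-1405 `PolyhedralTypeILiouville` kills the crux
(landed `quantisedSymmetry_liouvilleKillsProfile_proof`). -/
theorem not_crux_of_liouville (hL : PolyhedralTypeILiouville) : ¬ PolyhedralDssProfileExists :=
  quantisedSymmetry_liouvilleKillsProfile_proof hL

end Summit.NavierStokesRegularity.NavierStokesRegularity.Cruxes.PolyhedralDssProfileExists.StrategistS21g14
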